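import Summits.QuantumFields.YangMills.Theorems.FluctuationComparisonRegPrIntLS2BetaLaplaceLimit
import HarnessLib

/-!
# S2β · LAPLACE stub — letter LIMIT, the SUBTYPE EDITION of the door: data continuous only on a compact invariant set `Xc ⊆ SU(2)^{bonds}`

Cell `ym3-torus` (rung R3: continuum `SU(2)` Yang–Mills on `T³` — NOT `d = 4`, NOT infinite volume, NOT a mass gap, NOT Clay); width seat `ym-ust-20520-w4` g15;
helper of the crux `stmt-QuantumFields-20520` (`--supports`, NOT a proof of it).  Sequel of `…S2BetaLaplaceLimit.lean` (★★`laplaceLimit_corner`: the LIMIT door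
over an abstract compact carrier).  THE SEAM'S «GAP 1» (w5-20520 g13, 2026-08-29): the door asks `A, a, g` CONTINUOUS on the whole compact carrier, while CHART∞
(w3-20520 g13) delivers the chart map `Φ_V` and its density `jac_V` continuous only ON the closed, gauge-invariant, pivot-blind guarded chain set — and `jac_V = 0`
off it.  THIS FILE runs the door on the compact SUBTYPE `↥Xc` with the comapped measure and transfers every row through the measurable embedding `(↑)`:
* `map_injective_of_measurableEmbedding`, `setIntegral_model_eq_integral` (plumbing);
* ★★`laplaceLimit_corner_on` — AMBIENT `X₀` (`GaugeField (F.P K) 0 SU(2)`) with finite Borel `μ₀` (`ν_K`) and a continuous `μ₀`-preserving action `act₀` of the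
  compact group `Kg`; COMPACT `act₀`-invariant `Xc`; `A₀, a₀, g₀ : X₀ → ℝ` only `ContinuousOn Xc` (invariances ∕ growth asked on `Xc`); the transversal `σ₀` lands
  in `Xc`; `Θ'₀ (z, y) = act₀ (e z) (σ₀ y)` with window `W`, continuous density `J`, chart identity `hchart` stated IN `X₀`; the event `O₀` invariant on `Xc` and
  RELATIVELY open in `Xc`; `hmodel` with the SET integral `∫ x in Xc, e^{−(λβ_K)(A₀ − m)} · 1_{O₀} · a₀ ∂μ₀`; conclusion = `laplaceLimit_corner`'s with `a₀ (σ₀ 0)`;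
* ★★`laplaceLimit_corner_on'` — the same with `hmodel` over ALL of `X₀` (`∫ x, … ∂μ₀`, i.e. ✓KNIT `heightDensityCan_mul_exp_eq_integral` verbatim) plus the row
  `(hvan : ∀ x ∉ Xc, a₀ x = 0)` (WREG's density vanishes off the live set) — the LIMIT-INST feed form.

HONEST SCOPE.  A door; the rows are hypotheses for CHART∞ ∕ (C3) ∕ RG-K ∕ LIMIT-INST ∕ EXW ∕ GAP♯; DECAY, LAPLACE, S2β and the crux 20520 are NOT proved;
`YM3TorusSU2` NOT proved; the Yang–Mills mass gap (Clay) NOT proved.  Def-free; no `instance` ∕ `notation`; default heartbeats.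
References: [Balaban1985UV3] CMP 102 (1985) (2) p. 256, (41) p. 266; [HasenpflugRudolfSprungk2024] Ann. Appl. Probab. 34 (2024) §3.1, §3.4, App. 4.1 Thm 16;
[Breitung1994] LNM 1592 Thm 41 p. 56.
-/

noncomputable section

open MeasureTheory MeasureTheory.Measure Filter Topology Set Module Metric
open scoped Real InnerProductSpace ENNReal NNReal Pointwise
open Literature.MathematicalPhysics.QuantumFieldTheory.Balaban1983to89
open Literature.MathematicalPhysics.QuantumFieldTheory.Balaban1983to89.T3ContinuumYM3Torus
open Literature.MathematicalPhysics.QuantumFieldTheory.Balaban1983to89.T3UnitLawDensityEML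
open Summit.QuantumFields.YangMills.Theorems.FluctuationComparisonRegPrIntLWregGlue
open Summit.QuantumFields.YangMills.Theorems.FluctuationComparisonRegPrIntLS2BetaLaplaceKnit
open Summit.QuantumFields.YangMills.Theorems.FluctuationComparisonRegPrIntLS2BetaLaplaceLimit
open Literature.Analysis.Asymptotics

namespace Summit.QuantumFields.YangMills.Theorems.FluctuationComparisonRegPrIntLS2BetaLaplaceLimitOn

/-! ## §1 Plumbing and the subtype edition -/

section OnClosed

variable {Vt : Type*} [NormedAddCommGroup Vt] [InnerProductSpace ℝ Vt] [FiniteDimensional ℝ Vt]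
  [MeasurableSpace Vt] [BorelSpace Vt]
variable {Z : Type*} [NormedAddCommGroup Z] [NormedSpace ℝ Z] [FiniteDimensional ℝ Z]
  [MeasurableSpace Z] [BorelSpace Z]
variable {Kg : Type*} [Group Kg] [TopologicalSpace Kg] [IsTopologicalGroup Kg] [CompactSpace Kg]
  [FirstCountableTopology Kg] [MeasurableSpace Kg] [BorelSpace Kg]
variable {X₀ : Type*} [TopologicalSpace X₀] [T2Space X₀] [SecondCountableTopology X₀]
  [MeasurableSpace X₀] [BorelSpace X₀]
variable {act₀ : Kg → X₀ → X₀} {σ₀ : Vt → X₀} {e : Z → Kg} {Θ₀ : Kg × Vt → X₀} {Θ'₀ : Z × Vt → X₀} {Sst : Set Kg}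
  {ν : Measure Kg} [ν.IsHaarMeasure] {μ₀ : Measure X₀} [IsFiniteMeasure μ₀]
  {κ : Measure Z} [SFinite κ] [IsFiniteMeasureOnCompacts κ]

/-- The `map` of a measurable embedding is injective on measures (`comap ∘ map = id`). [folklore] -/
theorem map_injective_of_measurableEmbedding {α β : Type*} [MeasurableSpace α] [MeasurableSpace β] {f : α → β}
    (hf : MeasurableEmbedding f) {μ₁ μ₂ : Measure α} (h : μ₁.map f = μ₂.map f) : μ₁ = μ₂ := by
  rw [← hf.comap_map μ₁, ← hf.comap_map μ₂, h]

omit [TopologicalSpace X₀] [T2Space X₀] [SecondCountableTopology X₀] [BorelSpace X₀] [IsFiniteMeasure μ₀] in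
/-- When the amplitude vanishes off `Xc`, the model integral over `Xc` is the full one. [cite: Balaban1985UV3, (2) p. 256 (bookkeeping)] -/
theorem setIntegral_model_eq_integral {Xc O₀ : Set X₀} {A₀ a₀ : X₀ → ℝ} (hvan : ∀ x, x ∉ Xc → a₀ x = 0) (b m : ℝ) :
    ∫ x in Xc, Real.exp (-b * (A₀ x - m)) * O₀.indicator a₀ x ∂μ₀ = ∫ x, Real.exp (-b * (A₀ x - m)) * O₀.indicator a₀ x ∂μ₀ := by
  refine setIntegral_eq_integral_of_forall_compl_eq_zero fun x hx => ?_
  have : O₀.indicator a₀ x = 0 := by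
    by_cases hxO : x ∈ O₀
    · rw [indicator_of_mem hxO, hvan x hx]
    · rw [indicator_of_notMem hxO]
  rw [this, mul_zero]

/-- ★★ **LIMIT ON A COMPACT INVARIANT SET — THE SUBTYPE EDITION OF THE DOOR** (the seam's GAP 1: CHART∞ delivers `(Φ_V, jac_V)` continuous only on the compact,
invariant, pivot-blind guarded chain set `Xc ⊆ SU(2)^{bonds}`).  AMBIENT `X₀` with finite Borel `μ₀` and a continuous `μ₀`-preserving action of `Kg`; COMPACT invariant
`Xc`; `A₀, a₀, g₀` only `ContinuousOn Xc` (invariances ∕ growth asked on `Xc`); `σ₀` lands in `Xc`; `Θ'₀ (z, y) = act₀ (e z) (σ₀ y)` with `W, J, hchart` stated IN `X₀`;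
event `O₀` invariant on `Xc` and RELATIVELY open in `Xc`; `hmodel` with `∫ x in Xc, … ∂μ₀`.  CONCLUSION: as `laplaceLimit_corner`, with `a₀ (σ₀ 0)`.  Proof: the door
on `↥Xc` with `μ := μ₀.comap (↑)`, rows transferred through the measurable embedding (`map_comap`, `restrict_map`, `comap_map`, `integral_subtype_comap`, `nhds_subtype`).
[cite: Balaban1985UV3, (2) p. 256 and (41) p. 266] [cite: HasenpflugRudolfSprungk2024, §3.1 Assumption 3 (M)(T), §3.4, App. 4.1 Thm 16] [cite: Breitung1994, Thm 41 p. 56] -/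
theorem laplaceLimit_corner_on
    (F : T3Family) {γ : ℝ} (hγ : 0 < γ) {Jh Kh : ℕ} (hJK : Jh ≤ Kh)
    (S : Set (GaugeField (F.P Kh) 0 (Matrix.specialUnitaryGroup (Fin 2) ℂ))) (m : ℝ)
    (V : GaugeField (F.P Jh) 0 (Matrix.specialUnitaryGroup (Fin 2) ℂ))
    {Xc : Set X₀} (hXc : IsCompact Xc) (hXinv : ∀ k x, x ∈ Xc → act₀ k x ∈ Xc)
    {A₀ a₀ : X₀ → ℝ} {O₀ : Set X₀}
    (hmodel : ∀ lam : ℝ, 0 < lam →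
      heightDensityCan F (γ / lam) hJK S V * Real.exp (lam * (F.scheme ℰp γ).β Kh * m) =
        ∫ x in Xc, Real.exp (-(lam * (F.scheme ℰp γ).β Kh) * (A₀ x - m)) * O₀.indicator a₀ x ∂μ₀)
    (hact : Continuous fun p : Kg × X₀ => act₀ p.1 p.2)
    (hmul : ∀ k k' x, act₀ (k * k') x = act₀ k (act₀ k' x)) (hone : ∀ x, act₀ 1 x = x)
    (hpres : ∀ k, MeasurePreserving (act₀ k) μ₀ μ₀)
    (hσ : Continuous σ₀) (hσX : ∀ y, σ₀ y ∈ Xc) (he : Continuous e) (he1 : e 0 = 1) (he𝓝 : 𝓝 (1 : Kg) ≤ map e (𝓝 0))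
    (hΘ' : ∀ z y, Θ'₀ (z, y) = act₀ (e z) (σ₀ y))
    (hΘ'𝓝 : 𝓝 (σ₀ 0) ≤ map Θ'₀ (𝓝 0))
    {W : Set (Z × Vt)} (hWo : IsOpen W) (hinj : InjOn Θ'₀ W)
    {J : Z × Vt → ℝ} (hJc : ContinuousOn J W) (hJ0 : ∀ w ∈ W, 0 ≤ J w)
    (hchart : μ₀.restrict (Θ'₀ '' W) =
      (((κ.prod volume).restrict W).withDensity fun w => ENNReal.ofReal (J w)).map Θ'₀)
    {ρ : ℝ} (hρ : 0 < ρ) (hρW : closedBall (0 : Z) ρ ×ˢ {(0 : Vt)} ⊆ W)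
    (hstab : ∀ k : Kg, act₀ k (σ₀ 0) = σ₀ 0 → k ∈ Sst) (hfix : ∀ s ∈ Sst, ∀ y, act₀ s (σ₀ y) = σ₀ y)
    (hA : ContinuousOn A₀ Xc) (ha : ContinuousOn a₀ Xc)
    (hAinv : ∀ k, ∀ x ∈ Xc, A₀ (act₀ k x) = A₀ x) (hainv : ∀ k, ∀ x ∈ Xc, a₀ (act₀ k x) = a₀ x)
    (hO : IsOpen ((Subtype.val : Xc → X₀) ⁻¹' O₀)) (hOinv : ∀ k, ∀ x ∈ Xc, x ∈ O₀ → act₀ k x ∈ O₀)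
    (hO0 : σ₀ 0 ∈ O₀) (hmin : A₀ (σ₀ 0) = m)
    {g₀ : X₀ → ℝ} (hg : ContinuousOn g₀ Xc) (hg0 : ∀ x ∈ Xc, 0 ≤ g₀ x)
    (hgpos : ∀ x ∈ Xc, (∀ k, act₀ k (σ₀ 0) ≠ x) → 0 < g₀ x)
    (hgrow : ∀ x ∈ Xc, x ∈ O₀ → m + g₀ x ≤ A₀ x)
    {Ah : Vt →ₗ[ℝ] Vt} (hAs : Ah.IsSymmetric) (hpos : ∀ y, y ≠ 0 → 0 < ⟪Ah y, y⟫_ℝ)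
    (hS2 : (fun y => A₀ (σ₀ y) - A₀ (σ₀ 0) - (1 / 2) * ⟪Ah y, y⟫_ℝ) =o[𝓝 0] fun y => ‖y‖ ^ 2) :
    Tendsto (fun lam : ℝ => lam ^ ((finrank ℝ Vt : ℝ) / 2) *
        (heightDensityCan F (γ / lam) hJK S V * Real.exp (lam * (F.scheme ℰp γ).β Kh * m))) atTop
      (𝓝 (((2 * π) ^ ((finrank ℝ Vt : ℝ) / 2) * (ν.real univ *
          ((∫ z in ball (0 : Z) ρ, J (z, 0) ∂κ) / (ν (((e '' ball (0 : Z) ρ) * Sst)⁻¹)).toReal * a₀ (σ₀ 0) /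
            Real.sqrt (LinearMap.det Ah)))) / ((F.scheme ℰp γ).β Kh) ^ ((finrank ℝ Vt : ℝ) / 2))) := by
  classical
  -- the compact subtype and its measure
  haveI : CompactSpace Xc := isCompact_iff_compactSpace.mp hXc
  have hXm : MeasurableSet Xc := hXc.isClosed.measurableSet
  have hv : MeasurableEmbedding (Subtype.val : Xc → X₀) := MeasurableEmbedding.subtype_coe hXm
  set μ : Measure Xc := μ₀.comap Subtype.val with hμ_def
  have hμv : μ.map Subtype.val = μ₀.restrict Xc := by
    rw [hμ_def, hv.map_comap, Subtype.range_coe]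
  -- the transferred action, transversal, charts
  set actc : Kg → Xc → Xc := fun k x => ⟨act₀ k x.1, hXinv k x.1 x.2⟩ with hactc_def
  set σc : Vt → Xc := fun y => ⟨σ₀ y, hσX y⟩ with hσc_def
  set Θc : Kg × Vt → Xc := fun p => actc p.1 (σc p.2) with hΘc_def
  set Θ'c : Z × Vt → Xc := fun p => actc (e p.1) (σc p.2) with hΘ'c_def
  have hval_Θ' : ∀ p, (Θ'c p : X₀) = Θ'₀ p := fun p => (hΘ' p.1 p.2).symm
  have hcompΘ' : Subtype.val ∘ Θ'c = Θ'₀ := funext hval_Θ'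
  have hactc : Continuous fun p : Kg × Xc => actc p.1 p.2 :=
    (hact.comp (continuous_fst.prodMk (continuous_subtype_val.comp continuous_snd))).subtype_mk _
  have hmulc : ∀ k k' x, actc (k * k') x = actc k (actc k' x) := fun k k' x => Subtype.ext (hmul k k' x.1)
  have honec : ∀ x, actc 1 x = x := fun x => Subtype.ext (hone x.1)
  have hσc : Continuous σc := hσ.subtype_mk _
  have hΘc : ∀ k y, Θc (k, y) = actc k (σc y) := fun _ _ => rfl
  have hΘ'c : ∀ z y, Θ'c (z, y) = actc (e z) (σc y) := fun _ _ => rfl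
  have hΘ'c_cont : Continuous Θ'c := hactc.comp ((he.comp continuous_fst).prodMk (hσc.comp continuous_snd))
  -- measure preservation on the subtype
  have hpresc : ∀ k, MeasurePreserving (actc k) μ μ := by
    intro k
    have hk : Continuous (actc k) := hactc.comp (continuous_const.prodMk continuous_id)
    refine ⟨hk.measurable, map_injective_of_measurableEmbedding hv ?_⟩
    rw [Measure.map_map hv.measurable hk.measurable, hμv]
    have hcomp : (Subtype.val ∘ actc k) = act₀ k ∘ Subtype.val := funext fun x => rfl
    rw [hcomp, ← Measure.map_map (hpres k).measurable hv.measurable, hμv]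
    have hpre : act₀ k ⁻¹' Xc = Xc := by
      ext x
      refine ⟨fun hx => ?_, fun hx => hXinv k x hx⟩
      have h' := hXinv k⁻¹ _ hx
      rwa [← hmul, inv_mul_cancel, hone] at h'
    calc Measure.map (act₀ k) (μ₀.restrict Xc) = Measure.map (act₀ k) (μ₀.restrict (act₀ k ⁻¹' Xc)) := by rw [hpre]
      _ = (Measure.map (act₀ k) μ₀).restrict Xc := (Measure.restrict_map (hpres k).measurable hXm).symm
      _ = μ₀.restrict Xc := by rw [(hpres k).map_eq]
  -- the chart identity on the subtype
  have hpreim : Subtype.val ⁻¹' (Θ'₀ '' W) = Θ'c '' W := by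
    ext x
    constructor
    · rintro ⟨p, hp, hpx⟩
      exact ⟨p, hp, Subtype.ext (by rw [hval_Θ']; exact hpx)⟩
    · rintro ⟨p, hp, rfl⟩
      exact ⟨p, hp, (hval_Θ' p).symm⟩
  have hsub : Θ'₀ '' W ⊆ Xc := by
    rintro _ ⟨p, _, rfl⟩
    rw [← hval_Θ']
    exact (Θ'c p).2
  have hchartc : μ.restrict (Θ'c '' W) =
      (((κ.prod volume).restrict W).withDensity fun w => ENNReal.ofReal (J w)).map Θ'c := by
    refine map_injective_of_measurableEmbedding hv ?_
    rw [Measure.map_map hv.measurable hΘ'c_cont.measurable, hcompΘ', ← hchart, ← hpreim, ← hv.restrict_map, hμv,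
      Measure.restrict_restrict' hXm, Set.inter_eq_left.mpr hsub]
  -- neighbourhood filters and the slice, through the embedding
  have hΘ'𝓝c : 𝓝 (σc 0) ≤ map Θ'c (𝓝 0) := by
    rw [nhds_subtype]
    calc comap Subtype.val (𝓝 ((σc 0 : Xc) : X₀)) ≤ comap Subtype.val (map Θ'₀ (𝓝 0)) := comap_mono hΘ'𝓝
      _ = comap Subtype.val (map Subtype.val (map Θ'c (𝓝 0))) := by rw [Filter.map_map, hcompΘ']
      _ = map Θ'c (𝓝 0) := Filter.comap_map Subtype.val_injective
  have hinjc : InjOn Θ'c W := fun p hp q hq h =>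
    hinj hp hq (by rw [← hval_Θ', ← hval_Θ', h])
  have hstabc : ∀ k : Kg, actc k (σc 0) = σc 0 → k ∈ Sst := fun k h => hstab k (congrArg Subtype.val h)
  have hfixc : ∀ s ∈ Sst, ∀ y, actc s (σc y) = σc y := fun s hs y => Subtype.ext (hfix s hs y)
  -- the transferred phase, amplitude, event, growth function
  have hAc : Continuous (Xc.restrict A₀) := hA.restrict
  have hac : Continuous (Xc.restrict a₀) := ha.restrict
  have hgc : Continuous (Xc.restrict g₀) := hg.restrict
  have hAinvc : ∀ k (x : Xc), Xc.restrict A₀ (actc k x) = Xc.restrict A₀ x := fun k x => hAinv k x.1 x.2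
  have hainvc : ∀ k (x : Xc), Xc.restrict a₀ (actc k x) = Xc.restrict a₀ x := fun k x => hainv k x.1 x.2
  have hOinvc : ∀ k (x : Xc), x ∈ (Subtype.val ⁻¹' O₀ : Set Xc) → actc k x ∈ (Subtype.val ⁻¹' O₀ : Set Xc) :=
    fun k x hx => hOinv k x.1 x.2 hx
  have hO0c : σc 0 ∈ (Subtype.val ⁻¹' O₀ : Set Xc) := hO0
  have hminc : Xc.restrict A₀ (σc 0) = m := hmin
  have hg0c : ∀ x : Xc, 0 ≤ Xc.restrict g₀ x := fun x => hg0 x.1 x.2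
  have hgposc : ∀ x : Xc, (∀ k, actc k (σc 0) ≠ x) → 0 < Xc.restrict g₀ x :=
    fun x hx => hgpos x.1 x.2 fun k hk => hx k (Subtype.ext hk)
  have hgrowc : ∀ x ∈ (Subtype.val ⁻¹' O₀ : Set Xc), m + Xc.restrict g₀ x ≤ Xc.restrict A₀ x := fun x hx => hgrow x.1 x.2 hx
  have hS2c : (fun y => Xc.restrict A₀ (σc y) - Xc.restrict A₀ (σc 0) - (1 / 2) * ⟪Ah y, y⟫_ℝ) =o[𝓝 0] fun y => ‖y‖ ^ 2 := hS2
  -- the model integral on the subtype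
  have hmodelc : ∀ lam : ℝ, 0 < lam →
      heightDensityCan F (γ / lam) hJK S V * Real.exp (lam * (F.scheme ℰp γ).β Kh * m) =
        ∫ x, Real.exp (-(lam * (F.scheme ℰp γ).β Kh) * (Xc.restrict A₀ x - m)) * (Subtype.val ⁻¹' O₀ : Set Xc).indicator (Xc.restrict a₀) x ∂μ := by
    intro lam hlam
    rw [hmodel lam hlam, hμ_def, ← integral_subtype_comap hXm]
    refine integral_congr_ae (Eventually.of_forall fun x => ?_)
    show Real.exp (-(lam * (F.scheme ℰp γ).β Kh) * (A₀ x - m)) * O₀.indicator a₀ x =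
      Real.exp (-(lam * (F.scheme ℰp γ).β Kh) * (Xc.restrict A₀ x - m)) * (Subtype.val ⁻¹' O₀ : Set Xc).indicator (Xc.restrict a₀) x
    by_cases hx : (x : X₀) ∈ O₀
    · rw [indicator_of_mem hx, indicator_of_mem (show x ∈ (Subtype.val ⁻¹' O₀ : Set Xc) from hx)]
      rfl
    · rw [indicator_of_notMem hx, indicator_of_notMem (show x ∉ (Subtype.val ⁻¹' O₀ : Set Xc) from hx), mul_zero, mul_zero]
  -- the door on the subtype
  exact laplaceLimit_corner (ν := ν) (κ := κ) F hγ hJK S m V hmodelc hactc hmulc honec hpresc hσc he he1 he𝓝 hΘc hΘ'c hΘ'𝓝c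
    hWo hinjc hJc hJ0 hchartc hρ hρW hstabc hfixc hAc hac hAinvc hainvc hO hOinvc hO0c hminc hgc hg0c hgposc hgrowc hAs hpos hS2c

/-- ★★ **THE LIMIT-INST FEED FORM**: as `laplaceLimit_corner_on`, but with `hmodel` over ALL of `X₀` — ✓KNIT `heightDensityCan_mul_exp_eq_integral` verbatim, an
integral against `ν_K` on `SU(2)^{bonds}` — and the extra row `hvan : a₀ = 0` off `Xc` (WREG's density vanishes off the live set, which `Xc` contains).
[cite: Balaban1985UV3, (2) p. 256 and (41) p. 266] [cite: Breitung1994, Thm 41 p. 56] -/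
theorem laplaceLimit_corner_on'
    (F : T3Family) {γ : ℝ} (hγ : 0 < γ) {Jh Kh : ℕ} (hJK : Jh ≤ Kh)
    (S : Set (GaugeField (F.P Kh) 0 (Matrix.specialUnitaryGroup (Fin 2) ℂ))) (m : ℝ)
    (V : GaugeField (F.P Jh) 0 (Matrix.specialUnitaryGroup (Fin 2) ℂ))
    {Xc : Set X₀} (hXc : IsCompact Xc) (hXinv : ∀ k x, x ∈ Xc → act₀ k x ∈ Xc)
    {A₀ a₀ : X₀ → ℝ} {O₀ : Set X₀} (hvan : ∀ x, x ∉ Xc → a₀ x = 0)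
    (hmodel : ∀ lam : ℝ, 0 < lam →
      heightDensityCan F (γ / lam) hJK S V * Real.exp (lam * (F.scheme ℰp γ).β Kh * m) =
        ∫ x, Real.exp (-(lam * (F.scheme ℰp γ).β Kh) * (A₀ x - m)) * O₀.indicator a₀ x ∂μ₀)
    (hact : Continuous fun p : Kg × X₀ => act₀ p.1 p.2)
    (hmul : ∀ k k' x, act₀ (k * k') x = act₀ k (act₀ k' x)) (hone : ∀ x, act₀ 1 x = x)
    (hpres : ∀ k, MeasurePreserving (act₀ k) μ₀ μ₀)
    (hσ : Continuous σ₀) (hσX : ∀ y, σ₀ y ∈ Xc) (he : Continuous e) (he1 : e 0 = 1) (he𝓝 : 𝓝 (1 : Kg) ≤ map e (𝓝 0))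
    (hΘ' : ∀ z y, Θ'₀ (z, y) = act₀ (e z) (σ₀ y))
    (hΘ'𝓝 : 𝓝 (σ₀ 0) ≤ map Θ'₀ (𝓝 0))
    {W : Set (Z × Vt)} (hWo : IsOpen W) (hinj : InjOn Θ'₀ W)
    {J : Z × Vt → ℝ} (hJc : ContinuousOn J W) (hJ0 : ∀ w ∈ W, 0 ≤ J w)
    (hchart : μ₀.restrict (Θ'₀ '' W) =
      (((κ.prod volume).restrict W).withDensity fun w => ENNReal.ofReal (J w)).map Θ'₀)
    {ρ : ℝ} (hρ : 0 < ρ) (hρW : closedBall (0 : Z) ρ ×ˢ {(0 : Vt)} ⊆ W)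
    (hstab : ∀ k : Kg, act₀ k (σ₀ 0) = σ₀ 0 → k ∈ Sst) (hfix : ∀ s ∈ Sst, ∀ y, act₀ s (σ₀ y) = σ₀ y)
    (hA : ContinuousOn A₀ Xc) (ha : ContinuousOn a₀ Xc)
    (hAinv : ∀ k, ∀ x ∈ Xc, A₀ (act₀ k x) = A₀ x) (hainv : ∀ k, ∀ x ∈ Xc, a₀ (act₀ k x) = a₀ x)
    (hO : IsOpen ((Subtype.val : Xc → X₀) ⁻¹' O₀)) (hOinv : ∀ k, ∀ x ∈ Xc, x ∈ O₀ → act₀ k x ∈ O₀)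
    (hO0 : σ₀ 0 ∈ O₀) (hmin : A₀ (σ₀ 0) = m)
    {g₀ : X₀ → ℝ} (hg : ContinuousOn g₀ Xc) (hg0 : ∀ x ∈ Xc, 0 ≤ g₀ x)
    (hgpos : ∀ x ∈ Xc, (∀ k, act₀ k (σ₀ 0) ≠ x) → 0 < g₀ x)
    (hgrow : ∀ x ∈ Xc, x ∈ O₀ → m + g₀ x ≤ A₀ x)
    {Ah : Vt →ₗ[ℝ] Vt} (hAs : Ah.IsSymmetric) (hpos : ∀ y, y ≠ 0 → 0 < ⟪Ah y, y⟫_ℝ)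
    (hS2 : (fun y => A₀ (σ₀ y) - A₀ (σ₀ 0) - (1 / 2) * ⟪Ah y, y⟫_ℝ) =o[𝓝 0] fun y => ‖y‖ ^ 2) :
    Tendsto (fun lam : ℝ => lam ^ ((finrank ℝ Vt : ℝ) / 2) *
        (heightDensityCan F (γ / lam) hJK S V * Real.exp (lam * (F.scheme ℰp γ).β Kh * m))) atTop
      (𝓝 (((2 * π) ^ ((finrank ℝ Vt : ℝ) / 2) * (ν.real univ *
          ((∫ z in ball (0 : Z) ρ, J (z, 0) ∂κ) / (ν (((e '' ball (0 : Z) ρ) * Sst)⁻¹)).toReal * a₀ (σ₀ 0) /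
            Real.sqrt (LinearMap.det Ah)))) / ((F.scheme ℰp γ).β Kh) ^ ((finrank ℝ Vt : ℝ) / 2))) :=
  laplaceLimit_corner_on (ν := ν) (κ := κ) F hγ hJK S m V hXc hXinv
    (fun lam hlam => by rw [hmodel lam hlam, setIntegral_model_eq_integral hvan]) hact hmul hone hpres hσ hσX he he1 he𝓝 hΘ' hΘ'𝓝
    hWo hinj hJc hJ0 hchart hρ hρW hstab hfix hA ha hAinv hainv hO hOinv hO0 hmin hg hg0 hgpos hgrow hAs hpos hS2

end OnClosed


end Summit.QuantumFields.YangMills.Theorems.FluctuationComparisonRegPrIntLS2BetaLaplaceLimitOn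

end
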